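import Literature.Computability.AlgebraicComplexity.ValiantConjecture
import Literature.Computability.AlgebraicComplexity.SetMultilinear
import Mathlib.Algebra.BigOperators.Ring.Finset
import Mathlib.Logic.Equiv.Prod
import HarnessLib

/-!
# `d`-mode tensors, Kronecker products, circuit complexity; Brand et al. 2026, Thm. 2

Topic `Literature/Computability/AlgebraicComplexity`, after `ArithCircuit.lean` (fan-in-two circuit
complexity `complexity f` of a polynomial), `SetMultilinear.lean` (`IsSetMultilinear blk S f`),
`ValiantClasses.lean` (`VP k`, `VNP k`) and `ValiantConjecture.lean` (`VPNeVNPComplex`).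

The area so far models bilinear complexity by the rank of `3`-tensors `ι → κ → μ → K`
(`AsymptoticSpectrum.lean`) and polynomial complexity by `complexity : MvPolynomial σ k → ℕ`, with
no object joining the two for `d ≥ 4` modes (librarian framework note g35, 2026-08-17, §2/§4).
This file is the first, minimal piece of that bridge: a `d`-mode tensor in coordinates, the
set-multilinear polynomial it denotes, the Kronecker product, and the circuit complexity of a
tensor as the circuit complexity of its polynomial — enough to vendor the measure-robust part of
Brand–Curticapean–Kaski–Li–Orzel–Seppelt–Wang 2026.

## What is printed (arXiv:2602.11975)

* §2.1, p. 10: "A `d`-mode tensor ... is a set-multilinear polynomial together with its `d`-tuple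
  `(X₁, …, X_d)` of modes"; "`(𝔽ⁿ)^{⊗d}` for the set of `d`-tensors over `𝔽` with each mode of
  dimension `n`"; "The Kronecker product of two `d`-tensors `S ∈ 𝔽[X]` and `T ∈ 𝔽[Y]` with `X, Y`
  disjoint is the `d`-tensor `S ⊗ T` obtained from the polynomial product `ST` by viewing the
  Cartesian products `Xᵢ × Yᵢ` for `i ∈ [d]` as the `d` modes."
* §2.1, p. 11: "An arithmetic circuit over `𝔽[X]` is a DAG ...; the size of a circuit is the
  number of its wires. For a tensor `T ∈ (𝔽ⁿ)^{⊗d}`, we write `C(T)` for the size of a smallest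
  circuit computing `T`."
* Theorem 2 (p. 6, proof p. 21): "There are explicit tensors `T₁, T₂, …` and `U₁, U₂, …` with
  `T_d, U_d ∈ (ℂ²)^{⊗d}` for all `d ∈ ℕ` such that the following holds: If
  `C(T_d ⊗ U_d) ≤ poly(d, C(T_d), C(U_d))` for all `d ∈ ℕ`, then `VP = VNP`."  "Thus, the
  assumption `VP ≠ VNP` rules out submultiplicativity on `d`-mode tensors for all `d ∈ ℕ`."
* Theorem 3 (p. 6): "For all `0 < c < 1`, if circuit complexity is submultiplicative on
  `⌈4/c⌉²`-mode tensors, then permanents have circuits of size `O(2^{cn})`"; Theorem 22 (p. 18):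
  submultiplicativity on `4`-mode tensors implies `ω = 2`; Lemma 25 (p. 20): `per_n` is a
  projection of the bond-dimension-`2` grid graph tensor.

## How it is rendered here (relative to the tree's notions, D-0014)

* `ModeTensor d ι K := (Fin d → ι) → K` — a `d`-mode tensor in coordinates, every mode indexed
  by `ι` (`(Kⁿ)^{⊗d}` is `ModeTensor d (Fin n) K`); `ModeTensor.toMvPolynomial T =
  ∑ j, C (T j) * ∏ i, X (i, j i) ∈ K[Fin d × ι]`, set-multilinear for the block map `Prod.fst`
  (`isSetMultilinear_toMvPolynomial`, PROVED); `ModeTensor.kronecker S T : ModeTensor d (ι × κ) K`,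
  `(S ⊗ T) c = S (fst ∘ c) * T (snd ∘ c)` — the coordinate form of the printed "product `ST` with
  modes `Xᵢ × Yᵢ`": the substitution `z_{(i,(a,b))} ↦ x_{(i,a)} y_{(i,b)}` maps
  `(S ⊗ T).toMvPolynomial` to `S.toMvPolynomial(x) · T.toMvPolynomial(y)`
  (`aeval_kronecker_toMvPolynomial`, PROVED).
* `ModeTensor.circuitComplexity T := complexity T.toMvPolynomial` — the tree's FAN-IN-TWO GATE
  COUNT (Bürgisser's `L` up to a factor `≤ 3`, `ArithCircuit.lean`), not the printed wire count of
  unbounded fan-in circuits.  The two measures are linear in each other (binarising a circuit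
  with `w` wires costs `O(w)` fan-in-two gates, scalar wire labels and input gates included; a
  fan-in-two circuit with `g` gates has `≤ 2g` wires), which is why ONLY the polynomially-slack
  Theorem 2 is vendored over it: its hypothesis "`C(T_d ⊗ U_d) ≤ poly(d, C(T_d), C(U_d))`" is
  invariant under any change of size measure within polynomial (a fortiori constant) distortion,
  whereas the EXACT submultiplicativity `C(S ⊗ T) ≤ C(S) · C(T)` of Theorems 3 and 22 is not —
  those, and Lemma 25 (graph tensors `T_{G,N}` are not in the tree), are deliberately NOT vendored
  (librarian note g35 §2; work item wi-37902).
* `brandEtAl2026_thm_2` — NAMED FACT: there are sequences `T U : (d : ℕ) → ModeTensor d (Fin 2) ℂ`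
  such that a polynomial bound `C(T_d ⊗ U_d) ≤ c · (d + C(T_d) + C(U_d) + 1)^e` for all `d` forces
  `VP ℂ = VNP ℂ` (the tree's `VP`, `VNP` of `ValiantClasses.lean`; the negation of the conjecture
  `VPNeVNPComplex`).  "Explicit" is weakened to "there are" (the printed `T_d`, `U_d` are Kronecker
  products of the four perfect-matching tensors of the `(n+2) × (n+2)` grid, §7); "`≤ poly(…)`" is
  read as "bounded by ONE polynomial in `(d, C(T_d), C(U_d))` uniformly in `d`", rendered by the
  monotone envelope `c · (d + C(T_d) + C(U_d) + 1)^e` (every polynomial in non-negative arguments is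
  dominated by one of these, so the hypothesis class is unchanged).
  Users take `(h : brandEtAl2026_thm_2)`.

## References

* C. Brand, R. Curticapean, P. Kaski, B. Li, I. Orzel, T. Seppelt, J. Wang, *Beyond bilinear
  complexity: what works and what breaks with many modes?*, arXiv:2602.11975 (2026), §2.1
  (pp. 10–12), Thm. 2 and Thm. 3 (p. 6, proofs §7 p. 21), Thm. 22 (p. 18), Lemma 25 (p. 20).
  [BrandEtAl2026]
* P. Bürgisser, *Completeness and Reduction in Algebraic Complexity Theory* (2000), Def. 2.1.
  [Burgisser2000]
-/

noncomputable section

open MvPolynomial Finset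

namespace Literature.Computability.AlgebraicComplexity

universe u v w

/-! ### `d`-mode tensors in coordinates -/

/-- A **`d`-mode tensor in coordinates** with every mode indexed by `ι`: a coefficient array
`(Fin d → ι) → K`; `(Kⁿ)^{⊗d}` is `ModeTensor d (Fin n) K`.  (Brand et al. identify it with the
set-multilinear polynomial `ModeTensor.toMvPolynomial T`.) [cite: BrandEtAl2026, §2.1 (p. 10)] -/
abbrev ModeTensor (d : ℕ) (ι : Type v) (K : Type u) : Type max v u :=
  (Fin d → ι) → K

namespace ModeTensor

variable {d : ℕ} {ι : Type v} {κ : Type w} {K : Type u} [CommSemiring K]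

/-- The **set-multilinear polynomial of a tensor**: `∑ j, T j · ∏ i, X (i, j i)` in the variables
`Fin d × ι` (mode `i` = the block `{i} × ι`). [cite: BrandEtAl2026, §2.1 (p. 10)] -/
def toMvPolynomial [Fintype ι] (T : ModeTensor d ι K) : MvPolynomial (Fin d × ι) K :=
  ∑ j : Fin d → ι, C (T j) * ∏ i : Fin d, X (i, j i)

/-- The **Kronecker product** of two `d`-mode tensors, with modes `ι × κ`:
`(S ⊗ T) c = S (fst ∘ c) * T (snd ∘ c)` — the coordinate form of "the polynomial product `ST` with
the Cartesian products `Xᵢ × Yᵢ` as the `d` modes". [cite: BrandEtAl2026, §2.1 (p. 10)] -/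
def kronecker (S : ModeTensor d ι K) (T : ModeTensor d κ K) : ModeTensor d (ι × κ) K :=
  fun c => S (fun i => (c i).1) * T (fun i => (c i).2)

/-- The **circuit complexity of a tensor**: the tree's fan-in-two circuit complexity
(`Literature.Computability.AlgebraicComplexity.complexity`, Bürgisser's gate count) of its
set-multilinear polynomial.  Brand et al. count WIRES of unbounded fan-in circuits instead; the
two measures agree up to constant factors (module docstring). [cite: BrandEtAl2026, §2.1 (p. 11)]
[cite: Burgisser2000, Def. 2.1] -/
def circuitComplexity [Fintype ι] (T : ModeTensor d ι K) : ℕ :=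
  complexity T.toMvPolynomial

/-! ### Elementary properties (proved) -/

/-- Coordinates of a Kronecker product. [folklore] -/
@[simp]
theorem kronecker_apply (S : ModeTensor d ι K) (T : ModeTensor d κ K) (c : Fin d → ι × κ) :
    kronecker S T c = S (fun i => (c i).1) * T (fun i => (c i).2) :=
  rfl

/-- Coordinates of a Kronecker product at a pair of index words. [folklore] -/
theorem kronecker_apply_mk (S : ModeTensor d ι K) (T : ModeTensor d κ K) (a : Fin d → ι)
    (b : Fin d → κ) : kronecker S T (fun i => (a i, b i)) = S a * T b :=
  rfl

/-- Sums over index words in a product split into double sums over pairs of words. [folklore] -/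
theorem sum_arrow_prod {M : Type*} [AddCommMonoid M] [Fintype ι] [Fintype κ]
    (F : (Fin d → ι × κ) → M) :
    ∑ c, F c = ∑ a : Fin d → ι, ∑ b : Fin d → κ, F (fun i => (a i, b i)) := by
  have h := Fintype.sum_prod_type' (fun (a : Fin d → ι) (b : Fin d → κ) => F (fun i => (a i, b i)))
  rw [← h]
  exact Fintype.sum_equiv (Equiv.arrowProdEquivProdArrow (Fin d) (fun _ => ι) (fun _ => κ)) _ _
    (fun c => rfl)

/-- The monomial of an index word `j` is set-multilinear over any set `s` of modes when restricted
to `s`, in particular over all `d` modes (block map `Prod.fst`). [folklore] -/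
theorem isSetMultilinear_prod_X [Fintype ι] (j : Fin d → ι) (s : Finset (Fin d)) :
    IsSetMultilinear (Prod.fst : Fin d × ι → Fin d) s
      (∏ i ∈ s, (X (i, j i) : MvPolynomial (Fin d × ι) K)) := by
  classical
  induction s using Finset.induction_on with
  | empty =>
    rw [Finset.prod_empty, ← C_1]
    exact isSetMultilinear_C (blk := (Prod.fst : Fin d × ι → Fin d)) (1 : K)
  | insert a s ha ih =>
    rw [Finset.prod_insert ha, Finset.insert_eq]
    exact IsSetMultilinear.mul (blk := (Prod.fst : Fin d × ι → Fin d))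
      (hf := isSetMultilinear_X (R := K) (blk := (Prod.fst : Fin d × ι → Fin d)) (a, j a))
      (hg := ih) (h := Finset.disjoint_singleton_left.2 ha)

/-- **The polynomial of a tensor is set-multilinear** over the `d` modes `{i} × ι`.
[cite: BrandEtAl2026, §2.1 (p. 10)] -/
theorem isSetMultilinear_toMvPolynomial [Fintype ι] (T : ModeTensor d ι K) :
    IsSetMultilinear (Prod.fst : Fin d × ι → Fin d) Finset.univ T.toMvPolynomial := by
  classical
  unfold toMvPolynomial
  refine IsSetMultilinear.sum (blk := (Prod.fst : Fin d × ι → Fin d)) (s := Finset.univ)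
    (hf := fun j _ => ?_)
  rw [← smul_eq_C_mul]
  exact IsSetMultilinear.smul (blk := (Prod.fst : Fin d × ι → Fin d))
    (hf := isSetMultilinear_prod_X (K := K) j Finset.univ) (T j)

/-- The polynomial of a tensor is additive. [folklore] -/
theorem toMvPolynomial_add [Fintype ι] (S T : ModeTensor d ι K) :
    (S + T).toMvPolynomial = S.toMvPolynomial + T.toMvPolynomial := by
  simp [toMvPolynomial, add_mul, Finset.sum_add_distrib]

/-- The polynomial of the zero tensor is zero. [folklore] -/
@[simp]
theorem toMvPolynomial_zero [Fintype ι] : (0 : ModeTensor d ι K).toMvPolynomial = 0 := by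
  simp [toMvPolynomial]

/-- **Kronecker product = polynomial product with merged modes**: substituting
`z_{(i,(a,b))} ↦ x_{(i,a)} · y_{(i,b)}` in the polynomial of `S ⊗ T` gives the product of the
polynomials of `S` (in the `x`'s) and `T` (in the `y`'s). [cite: BrandEtAl2026, §2.1 (p. 10)] -/
theorem aeval_kronecker_toMvPolynomial [Fintype ι] [Fintype κ] (S : ModeTensor d ι K)
    (T : ModeTensor d κ K) :
    aeval (fun v : Fin d × (ι × κ) =>
        (X (Sum.inl (v.1, v.2.1)) * X (Sum.inr (v.1, v.2.2)) :
          MvPolynomial ((Fin d × ι) ⊕ (Fin d × κ)) K))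
        (kronecker S T).toMvPolynomial =
      rename Sum.inl S.toMvPolynomial * rename Sum.inr T.toMvPolynomial := by
  classical
  simp only [toMvPolynomial, kronecker, map_sum, map_mul, map_prod, aeval_C, aeval_X, rename_C,
    rename_X, algebraMap_eq]
  rw [Finset.sum_mul_sum, sum_arrow_prod]
  refine Finset.sum_congr rfl fun a _ => Finset.sum_congr rfl fun b _ => ?_
  simp only [Finset.prod_mul_distrib]
  ring

end ModeTensor

/-! ### Brand et al. 2026, Theorem 2 (named fact) -/

/-- **Brand–Curticapean–Kaski–Li–Orzel–Seppelt–Wang 2026, Thm. 2 (named fact): polynomial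
submultiplicativity of circuit complexity on explicit `d`-mode tensors would give `VP = VNP`.**
Printed: "There are explicit tensors `T₁, T₂, …` and `U₁, U₂, …` with `T_d, U_d ∈ (ℂ²)^{⊗d}` for
all `d ∈ ℕ` such that the following holds: If `C(T_d ⊗ U_d) ≤ poly(d, C(T_d), C(U_d))` for all
`d ∈ ℕ`, then `VP = VNP`."  Rendered: there are `T U : (d : ℕ) → ModeTensor d (Fin 2) ℂ` such
that, if for some `c e : ℕ` and all `d` the tree's circuit complexity satisfies
`C(T_d ⊗ U_d) ≤ c · (d + C(T_d) + C(U_d) + 1)^e`, then `VP ℂ = VNP ℂ`.  Deviations, all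
weakenings or measure-robust: "explicit" ↦ "there are"; `C` = the tree's fan-in-two gate count
`ModeTensor.circuitComplexity` instead of the printed wire count (constant-factor equivalent,
absorbed by the polynomial slack — this is why Thm. 3 / Thm. 22 with EXACT submultiplicativity are
not vendored); "`poly(d, C(T_d), C(U_d))`" ↦ one monotone polynomial envelope uniform in `d`.
Consequence as printed: `VP ≠ VNP` (`VPNeVNPComplex`) rules out such submultiplicativity.
Users take `(h : brandEtAl2026_thm_2)`. [cite: BrandEtAl2026, Thm. 2 (p. 6; proof §7, p. 21)] -/
def brandEtAl2026_thm_2 : Prop :=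
  ∃ T U : (d : ℕ) → ModeTensor d (Fin 2) ℂ,
    (∃ c e : ℕ, ∀ d : ℕ,
        (ModeTensor.kronecker (T d) (U d)).circuitComplexity ≤
          c * (d + (T d).circuitComplexity + (U d).circuitComplexity + 1) ^ e) →
      VP ℂ = VNP ℂ

/-- The printed reading "`VP ≠ VNP` rules out submultiplicativity": GIVEN Thm. 2 (hypothesis `h`)
and Valiant's hypothesis over `ℂ` (hypothesis `hV : VPNeVNPComplex`), for the witnessing sequences
no polynomial envelope bounds `C(T_d ⊗ U_d)` in terms of `d`, `C(T_d)`, `C(U_d)`.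
[cite: BrandEtAl2026, Thm. 2 and the sentence after it (p. 6)] -/
theorem not_polySubmultiplicative_of_VPNeVNP (h : brandEtAl2026_thm_2) (hV : VPNeVNPComplex) :
    ∃ T U : (d : ℕ) → ModeTensor d (Fin 2) ℂ,
      ∀ c e : ℕ, ∃ d : ℕ,
        c * (d + (T d).circuitComplexity + (U d).circuitComplexity + 1) ^ e <
          (ModeTensor.kronecker (T d) (U d)).circuitComplexity := by
  obtain ⟨T, U, hTU⟩ := h
  refine ⟨T, U, fun c e => ?_⟩
  by_contra hcon
  push Not at hcon
  exact hV (hTU ⟨c, e, hcon⟩)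

end Literature.Computability.AlgebraicComplexity

end
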